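import Summits.AtomisticToContinuum.HydrodynamicLimit.Theorems.InformationPercolationEngineCollisionRateCollisionMarkFluxLGOfEnvelope
import Summits.AtomisticToContinuum.HydrodynamicLimit.Theorems.RelayRaceLocalityRestartPrincipleMmrFluxConst
import Summits.AtomisticToContinuum.HydrodynamicLimit.Theorems.RelayRaceLocalityRestartPrincipleMmrEnergyHypConst
import Summits.AtomisticToContinuum.HydrodynamicLimit.Theorems.RelayRaceLocalityRestartPrincipleMmrEnergy
import HarnessLib

/-!
# Crux `RestartPrinciple` (stmt-AtomisticToContinuum-12503), line `IdeatorFourSketch` — the collision-flux stub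
# `stub_collisionFluxAlongFamily` REDUCED to the pair marginal envelope of the flow-evolved local Gibbs laws

Support file (`--supports stmt-AtomisticToContinuum-12503`; registered sub-goal `cf_collisionFluxAlongFamily_of_pairEnvelope`).
The stub `stub_collisionFluxAlongFamily` of the skeleton asks, along an Euler activity family `LG_τ = localGibbsLaw σ (a τ) (u τ) (θ τ)`,
for the two MEAN COLLISION-FLUX BOUNDS `(ε_N/(N+1)) · E_{LG_τ}[Σ_{collisions of [0,s]} Σ_{ordered contact pairs} m(vᵢ, v_k)] ≤ C s + e_N`
with the marks `m = ‖vᵢ − v_k‖` and `m = ‖vᵢ − v_k‖ (‖vᵢ‖ + ‖v_k‖)`. At constant profiles (invariant law) both are theorems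
(`mmr_collisionFlux_const`, `mmr_energyCollisionFlux_const`). For the NON-invariant laws of a genuine family the only use of invariance —
the stationarity step of the Campbell–Fatou window device of Cercignani–Illner–Pulvirenti — is removed by the tree's non-stationary
device `lintegral_le_liminf_mul_of_le_collisionSum` (`CollisionFluxMeanBoundNonStationary`), whose input is a ONE-WINDOW bound under the
evolved laws `(Φ_r)_* LG_τ`; and a one-window bound is a two-label STATIC estimate, supplied (exactly as in the landed F2
`Theorems.CollisionRate.stub_collisionMarkFluxLG_of_envelope` of crux stmt-13481, Markov form) by a PAIR MARGINAL ENVELOPE: the labelled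
two-particle marginals of `(Φ_r)_* LG_τ` dominated by `C ×` the free reference law `(Haar_{𝕋³} ⊗ N(u_R, θ_R))^{⊗2}`.

* `cf_lintegral_collisionMarkSum_le_of_pairEnvelope` — MEAN form of F2 for an arbitrary law `P` carried by the good set and an
  arbitrary s-finite reference velocity law `γ`: a pair envelope of constant `C_env` on `[0, R]` gives, for every measurable mark `b`
  of the two velocities and `0 < s ≤ R`,
  `E_P[Σ_{collisions of [0,s]} Σ_{(i,j)} b(vᵢ, vⱼ)] ≤ (N+1)² · C_env · 4 ε² s · ∫ ‖w − v‖ b(v, w) d(γ ⊗ γ)`;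
* `cf_collisionFluxAlongFamily_of_pairEnvelope` — THE REDUCTION in the stub's frame: IF along the family the pair marginals of
  `(Φ_r)_* LG_τ` (`τ ∈ [0,t]`, `r ∈ [0, t − τ]`, all `N`) are dominated by `(C + e_N) × (Haar ⊗ N(u_R, θ_R))^{⊗2}` with `e_N → 0`
  (for each fixed `N` finiteness is elementary — `LG_τ ≤ R_N ·` a homogeneous Gibbs law; the content is the UNIFORMITY in `N`, a
  Lanford-type a-priori envelope at fixed reduced density: the pair half of `CollisionRate.MarginalEnvelopeLG`, stmt-13481 (A), read
  along the family), THEN both conjuncts of `stub_collisionFluxAlongFamily` hold at `t`, with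
  `C_K = 16 σ³ (3θ_R + ‖u_R‖²) |C|`, `C_E = 32 σ³ (1 + 8(‖u_R‖⁴ + 15 θ_R²)) |C|`, `e(N) ∝ t |e_N|` (`(N+1) ε_N³ = σ³`; `s = 0` is void,
  `mmr_lintegral_finsum_Icc_zero`).

What remains open for the stub is precisely that envelope (open at `r > 0`; cf. the lead's analysis: no entropy route).

References: C. Cercignani, R. Illner, M. Pulvirenti, *The Mathematical Theory of Dilute Gases* (1994) §4.3, App. 4.A; I. Gallagher,
L. Saint-Raymond, B. Texier, *From Newton to Boltzmann* (2013) Prop. 4.1.1; H. Spohn, *Large Scale Dynamics of Interacting Particles*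
(1991) Part I §2.3.
-/

noncomputable section

namespace Summit.AtomisticToContinuum.HydrodynamicLimit.Theorems.RestartPrinciple.AgeDuhamelForgetting

open scoped BigOperators Topology ENNReal
open MeasureTheory Set Filter
open Literature.MathematicalPhysics.KineticTheory Literature.Analysis.FluidPDE Literature.Analysis.FunctionSpaces
open Summit.AtomisticToContinuum.HydrodynamicLimit.Theorems.NearConstantShortTimeHL
open Summit.AtomisticToContinuum.HydrodynamicLimit.Theorems.CollisionActivityTailsAbnormalActivityStatics
  (windowEvent pairTubeSet measurableSet_pairTubeSet measurableSet_windowEvent mem_windowEvent_of_contact)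
open Summit.AtomisticToContinuum.HydrodynamicLimit.Theorems.CollisionRate (lintegral_pairTubeSet_indicator_le)

/-! ## The mean collision-flux bound from a pair envelope (general law, general reference velocity law) -/

/-- **Mean collision flux of a velocity mark from a pair marginal envelope (non-stationary Campbell inequality, mean form).** For
`σ > 0`, a hard-sphere flow `Φ` of `N + 1` spheres of diameter `ε = hsDiameter σ N` on `𝕋³`, a law `P` carried by the good set, an
s-finite reference velocity law `γ` and a constant `C_env` such that on `[0, R]` every labelled pair marginal of the evolved law is
dominated, `E_P[f(Φ_r z i, Φ_r z j)] ≤ C_env ∫ f d((Haar ⊗ γ) ⊗ (Haar ⊗ γ))` (`i ≠ j`, `f ≥ 0` measurable): for every measurable mark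
`b ≥ 0` of the two velocities and `0 < s ≤ R`,
`E_P[Σ_{collision times r ∈ [0,s]} Σ_{ordered contact pairs (i,j)} b(vᵢ(r), vⱼ(r))] ≤ (N+1)² C_env · 4 ε² s · ∫ ‖w − v‖ b(v,w) d(γ ⊗ γ)` —
the window device without stationarity (`lintegral_le_liminf_mul_of_le_collisionSum`), window events cut from the swept tubes
(`exists_sweptTube`, `windowEvent`), the one-window functional of the pair `(k,l)` read as a measurable function of `(Φ_r z l, Φ_r z k)`
and bounded through the envelope by the STATIC integral `lintegral_pairTubeSet_indicator_le` (`≤ 4 ε² (s/M) · ∫ ‖w − v‖ b`); the mesh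
cancels, `M · (s/M) = s`. Mean-form twin of `CollisionRate.stub_collisionMarkFluxLG_of_envelope`. [cite: CIP1994, App. 4.A] -/
theorem cf_lintegral_collisionMarkSum_le_of_pairEnvelope {σ : ℝ} (hσ : 0 < σ) {N : ℕ}
    (Φ : HardSphereFlow (Torus.geometry (Fin 3)) (hsDiameter σ N) (N + 1))
    (P : Measure (Config (N + 1) (Fin 3) T3)) (hP : P Φ.goodᶜ = 0) (γ : Measure V3) [SFinite γ] (Cenv : ℝ≥0∞) {R : ℝ}
    (henv : ∀ r ∈ Icc (0 : ℝ) R, ∀ i j : Fin (N + 1), i ≠ j → ∀ f : (T3 × V3) × (T3 × V3) → ℝ≥0∞, Measurable f →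
      ∫⁻ z, f (Φ.flow r z i, Φ.flow r z j) ∂P ≤
        Cenv * ∫⁻ q, f q ∂(((volume : Measure T3).prod γ).prod ((volume : Measure T3).prod γ)))
    {b : V3 × V3 → ℝ≥0∞} (hbm : Measurable b) {s : ℝ} (hs : 0 < s) (hsR : s ≤ R) :
    ∫⁻ z, (∑ᶠ r ∈ collisionTimes (Torus.geometry (Fin 3)) (hsDiameter σ N) (fun t => Φ.flow t z) ∩ Icc 0 s,
      ∑ i, ∑ j, (if i ≠ j ∧ ‖(Torus.geometry (Fin 3)).sepVec (Φ.flow r z i).1 (Φ.flow r z j).1‖ = hsDiameter σ N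
        then b ((Φ.flow r z i).2, (Φ.flow r z j).2) else 0)) ∂P ≤
      ((N + 1 : ℕ) : ℝ≥0∞) * ((N + 1 : ℕ) : ℝ≥0∞) * (Cenv * (ENNReal.ofReal (4 * hsDiameter σ N ^ 2 * s) *
        ∫⁻ p, ENNReal.ofReal ‖p.2 - p.1‖ * b p ∂(γ.prod γ))) := by
  classical
  -- adapted from `CollisionRate.stub_collisionMarkFluxLG_of_envelope` (Markov form ↦ mean form; `LG` ↦ `P`, `N(u,θ)` ↦ `γ`)
  have hε : 0 < hsDiameter σ N := hsDiameter_pos hσ N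
  set I : ℝ≥0∞ := ∫⁻ p, ENNReal.ofReal ‖p.2 - p.1‖ * b p ∂(γ.prod γ) with hIdef
  -- the mark: a function of the two velocities, unchanged along free flight
  set F : Config (N + 1) (Fin 3) T3 → Fin (N + 1) → Fin (N + 1) → ℝ≥0∞ :=
    fun w i j => b ((w i).2, (w j).2) with hFdef
  have hFm : ∀ i j, Measurable fun w => F w i j :=
    fun i j => hbm.comp ((measurable_pi_apply i).snd.prodMk (measurable_pi_apply j).snd)
  have hFfree : ∀ (t : ℝ) (w : Config (N + 1) (Fin 3) T3) (i j : Fin (N + 1)),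
      F (freeFlight (Torus.geometry (Fin 3)) (-t) w) i j = F w i j := by
    intro t w i j
    simp only [hFdef, freeFlight_apply]
  -- the swept tubes of mesh `s / M` and the window events cut from them
  have htube : ∀ M : ℕ, ∃ S : V3 → Set V3, MeasurableSet {q : V3 × V3 | q.1 ∈ S q.2} ∧
      (∀ v, volume (S v) ≤ ENNReal.ofReal (4 * (hsDiameter σ N) ^ 2 * (s / M) * ‖v‖)) ∧
      ∀ (v r : V3) (s' : ℝ), (hsDiameter σ N) ≤ ‖r‖ → s' ∈ Icc 0 (s / M) → ‖r + s' • v‖ = (hsDiameter σ N) → r ∈ S v :=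
    fun M => exists_sweptTube hε (div_nonneg hs.le (Nat.cast_nonneg M))
  choose S hSm hSvol hS using htube
  set E : ℕ → Fin (N + 1) → Fin (N + 1) → Set (Config (N + 1) (Fin 3) T3) :=
    fun M k l => windowEvent (S M) k l with hE
  set n : ℝ≥0∞ := ((N + 1 : ℕ) : ℝ≥0∞) with hn
  set B : ℕ → ℝ≥0∞ := fun M => n * n * (Cenv * (ENNReal.ofReal (4 * (hsDiameter σ N) ^ 2 * (s / M)) * I)) with hB
  -- the one-window bound of ONE ordered pair under the law at a time `r ∈ [0, R]`: envelope + statics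
  have hterm : ∀ (M : ℕ), ∀ r ∈ Icc (0 : ℝ) R, ∀ k l : Fin (N + 1), k ≠ l →
      ∫⁻ x, (E M k l).indicator (fun x => F x k l) x ∂(P.map (Φ.flow r)) ≤
        Cenv * (ENNReal.ofReal (4 * (hsDiameter σ N) ^ 2 * (s / M)) * I) := by
    intro M r hr k l hkl
    set f : (T3 × V3) × (T3 × V3) → ℝ≥0∞ := fun q =>
      (pairTubeSet (S M)).indicator (fun q' => b q'.2) (q.2.1 - q.1.1, q.2.2, q.1.2) with hf
    have hfm : Measurable f :=
      ((hbm.comp measurable_snd).indicator (measurableSet_pairTubeSet (hSm M))).comp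
        ((measurable_snd.fst.sub measurable_fst.fst).prodMk (measurable_snd.snd.prodMk measurable_fst.snd))
    have hpt : ∀ w : Config (N + 1) (Fin 3) T3, (E M k l).indicator (fun x => F x k l) w = f (w l, w k) := by
      intro w
      by_cases hw : w ∈ E M k l
      · have hw' : ((w k).1 - (w l).1, (w k).2, (w l).2) ∈ pairTubeSet (S M) := hw
        rw [indicator_of_mem hw, hf]
        exact (indicator_of_mem hw' fun q' : T3 × V3 × V3 => b q'.2).symm
      · have hw' : ((w k).1 - (w l).1, (w k).2, (w l).2) ∉ pairTubeSet (S M) := hw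
        rw [indicator_of_notMem hw, hf]
        exact (indicator_of_notMem hw' fun q' : T3 × V3 × V3 => b q'.2).symm
    calc ∫⁻ x, (E M k l).indicator (fun x => F x k l) x ∂(P.map (Φ.flow r))
        ≤ ∫⁻ z, (E M k l).indicator (fun x => F x k l) (Φ.flow r z) ∂P := lintegral_map_le _ _
      _ = ∫⁻ z, f (Φ.flow r z l, Φ.flow r z k) ∂P := lintegral_congr fun z => hpt _
      _ ≤ Cenv * ∫⁻ q, f q ∂(((volume : Measure T3).prod γ).prod ((volume : Measure T3).prod γ)) :=
          henv r hr l k hkl.symm f hfm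
      _ ≤ Cenv * (ENNReal.ofReal (4 * (hsDiameter σ N) ^ 2 * (s / M)) * I) := by
          gcongr
          exact lintegral_pairTubeSet_indicator_le γ (hSm M) (hSvol M) hbm
  -- the one-window bound under the laws at ALL times of the window `[0, s] ⊆ [0, R]`
  have hBle : ∀ (M : ℕ), ∀ r ∈ Icc (0 : ℝ) (0 + s),
      ∫⁻ x, ∑ k : Fin (N + 1), ∑ l : Fin (N + 1),
        (if k ≠ l then (E M k l).indicator (fun x => F x k l) x else 0) ∂(P.map (Φ.flow r)) ≤ B M := by
    intro M r hr
    have hr' : r ∈ Icc (0 : ℝ) R := ⟨hr.1, by linarith [hr.2]⟩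
    have hterm' : ∀ k l : Fin (N + 1), ∫⁻ x, (if k ≠ l then (E M k l).indicator (fun x => F x k l) x else 0)
        ∂(P.map (Φ.flow r)) ≤ Cenv * (ENNReal.ofReal (4 * (hsDiameter σ N) ^ 2 * (s / M)) * I) := by
      intro k l
      by_cases hkl : k ≠ l
      · simp only [if_pos hkl]; exact hterm M r hr' k l hkl
      · simp only [if_neg hkl, lintegral_zero, zero_le]
    have hmeas : ∀ k l : Fin (N + 1), Measurable fun x : Config (N + 1) (Fin 3) T3 =>
        (if k ≠ l then (E M k l).indicator (fun x => F x k l) x else 0) := by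
      intro k l
      by_cases hkl : k ≠ l
      · simp only [if_pos hkl]; exact (hFm k l).indicator (measurableSet_windowEvent (hSm M) k l)
      · simp only [if_neg hkl]; exact measurable_const
    calc _ = ∑ k : Fin (N + 1), ∑ l : Fin (N + 1), ∫⁻ x, (if k ≠ l then (E M k l).indicator (fun x => F x k l) x else 0)
          ∂(P.map (Φ.flow r)) := by
          rw [lintegral_finsetSum _ fun k _ => Finset.measurable_sum _ fun l _ => hmeas k l]
          exact Finset.sum_congr rfl fun k _ => lintegral_finsetSum _ fun l _ => hmeas k l
      _ ≤ ∑ _k : Fin (N + 1), ∑ _l : Fin (N + 1), Cenv * (ENNReal.ofReal (4 * (hsDiameter σ N) ^ 2 * (s / M)) * I) :=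
          Finset.sum_le_sum fun k _ => Finset.sum_le_sum fun l _ => hterm' k l
      _ = B M := by
          simp only [Finset.sum_const, Finset.card_univ, Fintype.card_fin, nsmul_eq_mul, hB, hn]; ring
  -- the window inequality (no stationarity), applied to the collision sum itself
  have hgen := lintegral_le_liminf_mul_of_le_collisionSum Φ P hP hs 0 F E
    (fun M k l => measurableSet_windowEvent (hSm M) k l)
    (fun M k l hkl x hx t' ht' hc => mem_windowEvent_of_contact (hS M) hkl hx ht' hc)
    (fun _ => F) (fun _ k l => hFm k l) (fun M k l _ x _ t' _ _ => (hFfree t' x k l).le) B hBle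
    (fun z => ∑ᶠ r ∈ collisionTimes (Torus.geometry (Fin 3)) (hsDiameter σ N) (fun t => Φ.flow t z) ∩ Icc 0 s,
      ∑ i, ∑ j, (if i ≠ j ∧ ‖(Torus.geometry (Fin 3)).sepVec (Φ.flow r z i).1 (Φ.flow r z j).1‖ = hsDiameter σ N
        then b ((Φ.flow r z i).2, (Φ.flow r z j).2) else 0))
    (fun z _ => by simp only [zero_add, hFdef]; exact le_rfl)
  -- `liminf_M M · B M ≤ (N+1)² C_env · 4 ε² s · I`
  set L : ℝ≥0∞ := n * n * (Cenv * (ENNReal.ofReal (4 * (hsDiameter σ N) ^ 2 * s) * I)) with hL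
  have hMB : ∀ M : ℕ, 1 ≤ M → (M : ℝ≥0∞) * B M = L := by
    intro M hM
    have hM0 : (0 : ℝ) < M := by exact_mod_cast hM
    have hkey : (M : ℝ≥0∞) * ENNReal.ofReal (4 * (hsDiameter σ N) ^ 2 * (s / M)) = ENNReal.ofReal (4 * (hsDiameter σ N) ^ 2 * s) := by
      rw [← ENNReal.ofReal_natCast, ← ENNReal.ofReal_mul (Nat.cast_nonneg M)]
      congr 1; field_simp
    rw [hB, hL, ← hkey]; ring
  have hlim : liminf (fun M : ℕ => (M : ℝ≥0∞) * B M) atTop ≤ L :=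
    liminf_le_of_frequently_le' (((eventually_ge_atTop 1).mono fun M hM => (hMB M hM).le).frequently)
  exact hgen.trans hlim

/-! ## Constants -/

/-- **The scaling `(ε_N/(N+1)) · (N+1)² · 4 ε_N² s = 4 σ³ s` and the bookkeeping of the constants**: with a flux integral `I ≤ J`,
`(ε/(N+1)) · ((N+1)² (C + e) · 4 ε² s · I) ≤ 4σ³ J |C| s + 4σ³ J t |e|` for `0 ≤ s ≤ t` (`(N+1) ε³ = σ³`). [folklore] -/
theorem cf_scaled_pairEnvelope_bound_le {σ : ℝ} (hσ : 0 < σ) (N : ℕ) (C e : ℝ) {s t J : ℝ} (hJ : 0 ≤ J) (hs : 0 ≤ s)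
    (hst : s ≤ t) {I : ℝ≥0∞} (hI : I ≤ ENNReal.ofReal J) :
    ENNReal.ofReal (hsDiameter σ N / ((N + 1 : ℕ) : ℝ)) * (((N + 1 : ℕ) : ℝ≥0∞) * ((N + 1 : ℕ) : ℝ≥0∞) *
      (ENNReal.ofReal (C + e) * (ENNReal.ofReal (4 * hsDiameter σ N ^ 2 * s) * I))) ≤
      ENNReal.ofReal (4 * σ ^ 3 * J * |C| * s + 4 * σ ^ 3 * J * t * |e|) := by
  set ε : ℝ := hsDiameter σ N with hεdef
  have hε : 0 < ε := hsDiameter_pos hσ N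
  set n' : ℝ := ((N + 1 : ℕ) : ℝ) with hn'
  have hn0 : 0 < n' := by rw [hn']; positivity
  have hn : ((N + 1 : ℕ) : ℝ≥0∞) = ENNReal.ofReal n' := by rw [hn', ENNReal.ofReal_natCast]
  have hCe : ENNReal.ofReal (C + e) ≤ ENNReal.ofReal (|C| + |e|) :=
    ENNReal.ofReal_le_ofReal (add_le_add (le_abs_self C) (le_abs_self e))
  have hcube : n' * ε ^ 3 = σ ^ 3 := succ_mul_hsDiameter_pow_three σ N
  have hreal : ε / n' * (n' * n' * ((|C| + |e|) * (4 * ε ^ 2 * s * J))) ≤ 4 * σ ^ 3 * J * |C| * s + 4 * σ ^ 3 * J * t * |e| := by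
    have h1 : ε / n' * (n' * n' * ((|C| + |e|) * (4 * ε ^ 2 * s * J))) = 4 * (n' * ε ^ 3) * J * (|C| + |e|) * s := by
      field_simp
    rw [h1, hcube]
    have h2 : 0 ≤ 4 * σ ^ 3 * J * |e| := by positivity
    nlinarith [mul_le_mul_of_nonneg_left hst h2, abs_nonneg C, abs_nonneg e]
  calc ENNReal.ofReal (ε / n') * (((N + 1 : ℕ) : ℝ≥0∞) * ((N + 1 : ℕ) : ℝ≥0∞) *
        (ENNReal.ofReal (C + e) * (ENNReal.ofReal (4 * ε ^ 2 * s) * I)))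
      ≤ ENNReal.ofReal (ε / n') * (ENNReal.ofReal n' * ENNReal.ofReal n' *
          (ENNReal.ofReal (|C| + |e|) * (ENNReal.ofReal (4 * ε ^ 2 * s) * ENNReal.ofReal J))) := by
        rw [hn]
        gcongr
    _ = ENNReal.ofReal (ε / n' * (n' * n' * ((|C| + |e|) * (4 * ε ^ 2 * s * J)))) := by
        rw [ENNReal.ofReal_mul (div_nonneg hε.le hn0.le), ENNReal.ofReal_mul (mul_nonneg hn0.le hn0.le),
          ENNReal.ofReal_mul hn0.le, ENNReal.ofReal_mul (by positivity : 0 ≤ |C| + |e|),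
          ENNReal.ofReal_mul (by positivity : 0 ≤ 4 * ε ^ 2 * s)]
    _ ≤ _ := ENNReal.ofReal_le_ofReal hreal

/-! ## The reduction in the stub's frame -/

/-- **`stub_collisionFluxAlongFamily` ⟸ the pair marginal envelope of the flow-evolved local Gibbs laws along the family**
(registered sub-goal `cf_collisionFluxAlongFamily_of_pairEnvelope` of crux stmt-AtomisticToContinuum-12503, line `IdeatorFourSketch`).
For `σ > 0`, any profile families `θ, u, a`, any flow family `Φ` and any `t`: IF there are a reference Maxwellian `N(u_R, θ_R)`,
`C` and `e_N → 0` such that for every `N`, `τ ∈ [0,t]`, `r ∈ [0, t − τ]` and distinct labels `i, j` the labelled pair marginal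
of `(Φ_r)_* LG_τ`, `LG_τ = localGibbsLaw σ (a τ) (u τ) (θ τ) N (Φ N)`, is dominated by `(C + e_N) ×` the free reference law
`(Haar ⊗ N(u_R, θ_R))^{⊗2}` (as `lintegral` inequalities over measurable `f ≥ 0`), THEN both mean collision-flux bounds of the
stub hold at `t`: the relative-speed mark with `C_K = 4σ³ · 4(3θ_R + ‖u_R‖²) · |C|`, the energy mark with
`C_E = 4σ³ · 8(1 + 8(‖u_R‖⁴ + 15θ_R²)) · |C|`, errors `4σ³ J t |e_N| → 0` (`cf_lintegral_collisionMarkSum_le_of_pairEnvelope` with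
`P = LG_τ` — carried by the good set, `localGibbsMeasure_absolutelyContinuous` — window `[0, s] ⊆ [0, t − τ]`, the Gaussian flux
integrals `mmr_lintegral_norm_sub_sq_prod_gaussMeasure_le`, `mmr_lintegral_energyMark_prod_gaussMeasure_le`, and `(N+1) ε_N³ = σ³`;
`s = 0`: `mmr_lintegral_finsum_Icc_zero`). The hypothesis is the pair half of the Lanford-type envelope `CollisionRate.MarginalEnvelopeLG`
(stmt-13481 (A)) read along the family; it is elementary for each fixed `N` and at `r = 0`, open uniformly in `N` at `r > 0`.
[cite: CIP1994, App. 4.A] -/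
theorem cf_collisionFluxAlongFamily_of_pairEnvelope : ∀ (σ : ℝ), 0 < σ → ∀ (θ : ℝ → T3 → ℝ) (u : ℝ → T3 → V3) (Φ : (N : ℕ) → HardSphereFlow (Torus.geometry (Fin 3)) (hsDiameter σ N) (N + 1)) (a : ℝ → T3 → ℝ) (t : ℝ), (∃ uR : V3, ∃ θR : ℝ, 0 < θR ∧ ∃ C : ℝ, ∃ e : ℕ → ℝ, Tendsto e atTop (𝓝 0) ∧ ∀ N : ℕ, ∀ τ ∈ Set.Icc 0 t, ∀ r ∈ Set.Icc 0 (t - τ), ∀ i j : Fin (N + 1), i ≠ j → ∀ f : (T3 × V3) × (T3 × V3) → ℝ≥0∞, Measurable f → ∫⁻ z, f ((Φ N).flow r z i, (Φ N).flow r z j) ∂(localGibbsLaw σ (a τ) (u τ) (θ τ) N (Φ N)) ≤ ENNReal.ofReal (C + e N) * ∫⁻ q, f q ∂(((volume : Measure T3).prod (gaussMeasure uR θR)).prod ((volume : Measure T3).prod (gaussMeasure uR θR)))) → (∃ CK : ℝ, ∃ eK : ℕ → ℝ, Tendsto eK atTop (𝓝 0) ∧ ∀ N : ℕ, ∀ s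 ∈ Set.Icc 0 t, ∀ τ ∈ Set.Icc 0 t, s + τ ≤ t → ENNReal.ofReal (hsDiameter σ N / ((N + 1 : ℕ) : ℝ)) * ∫⁻ z, (∑ᶠ r ∈ collisionTimes (Torus.geometry (Fin 3)) (hsDiameter σ N) (fun t => (Φ N).flow t z) ∩ Set.Icc 0 s, ∑ i, ∑ k, (if i ≠ k ∧ ‖(Torus.geometry (Fin 3)).sepVec ((Φ N).flow r z i).1 ((Φ N).flow r z k).1‖ = hsDiameter σ N then ENNReal.ofReal ‖((Φ N).flow r z i).2 - ((Φ N).flow r z k).2‖ else 0)) ∂(localGibbsLaw σ (a τ) (u τ) (θ τ) N (Φ N)) ≤ ENNReal.ofReal (CK * s + eK N)) ∧ (∃ CE : ℝ, ∃ eE : ℕ → ℝ, Tendsto eE atTop (𝓝 0) ∧ ∀ N : ℕ, ∀ s ∈ Set.Icc 0 t, ∀ τ ∈ Set.Icc 0 t, s + τ ≤ t → ENNReal.ofReal (hsDiameter σ N / ((N + 1 : ℕ) : ℝ)) * ∫⁻ z, (∑ᶠ r ∈ collisionTimes (Torus.geometry (Fin 3)) (hsDiameter σ N) (fun t => (Φ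 N).flow t z) ∩ Set.Icc 0 s, ∑ i, ∑ k, (if i ≠ k ∧ ‖(Torus.geometry (Fin 3)).sepVec ((Φ N).flow r z i).1 ((Φ N).flow r z k).1‖ = hsDiameter σ N then ENNReal.ofReal (‖((Φ N).flow r z i).2 - ((Φ N).flow r z k).2‖ * (‖((Φ N).flow r z i).2‖ + ‖((Φ N).flow r z k).2‖)) else 0)) ∂(localGibbsLaw σ (a τ) (u τ) (θ τ) N (Φ N)) ≤ ENNReal.ofReal (CE * s + eE N)) := by
  intro σ hσ θ u Φ a t hyp
  obtain ⟨uR, θR, hθR, C, e, he, henv⟩ := hyp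
  -- the laws are carried by the good sets
  have hac : ∀ (N : ℕ) (τ : ℝ), localGibbsLaw σ (a τ) (u τ) (θ τ) N (Φ N) ≪
      liouville (Torus.geometry (Fin 3)) (N + 1) (hsDiameter σ N) := fun N τ => by
    rw [localGibbsLaw_eq]
    exact localGibbsMeasure_absolutelyContinuous σ _ _ _ N (Φ N)
  have hgood : ∀ (N : ℕ) (τ : ℝ), localGibbsLaw σ (a τ) (u τ) (θ τ) N (Φ N) (Φ N).goodᶜ = 0 :=
    fun N τ => hac N τ (Φ N).measure_compl_good
  -- the Gaussian flux integrals of the two marks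
  set γ : Measure V3 := gaussMeasure uR θR with hγ
  set JK : ℝ := 4 * (3 * θR + ‖uR‖ ^ 2) with hJK
  set JE : ℝ := 8 * (1 + 8 * (‖uR‖ ^ 4 + 15 * θR ^ 2)) with hJE
  have hJK0 : 0 ≤ JK := by positivity
  have hJE0 : 0 ≤ JE := by positivity
  have hbK : Measurable fun p : V3 × V3 => ENNReal.ofReal ‖p.1 - p.2‖ := by fun_prop
  have hbE : Measurable fun p : V3 × V3 => ENNReal.ofReal (‖p.1 - p.2‖ * (‖p.1‖ + ‖p.2‖)) := by fun_prop
  have hIK : ∫⁻ p, ENNReal.ofReal ‖p.2 - p.1‖ * ENNReal.ofReal ‖p.1 - p.2‖ ∂(γ.prod γ) ≤ ENNReal.ofReal JK :=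
    mmr_lintegral_norm_sub_sq_prod_gaussMeasure_le uR hθR
  have hIE : ∫⁻ p, ENNReal.ofReal ‖p.2 - p.1‖ * ENNReal.ofReal (‖p.1 - p.2‖ * (‖p.1‖ + ‖p.2‖)) ∂(γ.prod γ) ≤
      ENNReal.ofReal JE := mmr_lintegral_energyMark_prod_gaussMeasure_le uR hθR
  -- the envelope on `[0, t - τ]`, as an `ℝ≥0∞` constant
  have henv' : ∀ (N : ℕ), ∀ τ ∈ Set.Icc (0 : ℝ) t, ∀ r ∈ Icc (0 : ℝ) (t - τ), ∀ i j : Fin (N + 1), i ≠ j →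
      ∀ f : (T3 × V3) × (T3 × V3) → ℝ≥0∞, Measurable f →
      ∫⁻ z, f ((Φ N).flow r z i, (Φ N).flow r z j) ∂(localGibbsLaw σ (a τ) (u τ) (θ τ) N (Φ N)) ≤
        ENNReal.ofReal (C + e N) * ∫⁻ q, f q ∂(((volume : Measure T3).prod γ).prod ((volume : Measure T3).prod γ)) :=
    fun N τ hτ r hr i j hij f hf => henv N τ hτ r hr i j hij f hf
  -- the errors tend to `0`
  have htend : ∀ J : ℝ, Tendsto (fun N : ℕ => 4 * σ ^ 3 * J * t * |e N|) atTop (𝓝 0) := fun J => by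
    simpa using (he.abs.const_mul (4 * σ ^ 3 * J * t))
  refine ⟨⟨4 * σ ^ 3 * JK * |C|, fun N => 4 * σ ^ 3 * JK * t * |e N|, htend JK, ?_⟩,
    ⟨4 * σ ^ 3 * JE * |C|, fun N => 4 * σ ^ 3 * JE * t * |e N|, htend JE, ?_⟩⟩
  · intro N s hs τ hτ hst
    rcases hs.1.eq_or_lt with h0 | hs0
    · -- `s = 0`: the collision sum over `{0}` vanishes a.e.
      subst h0
      have hz : ∫⁻ z, (∑ᶠ r ∈ collisionTimes (Torus.geometry (Fin 3)) (hsDiameter σ N) (fun t => (Φ N).flow t z) ∩ Set.Icc 0 0,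
          ∑ i, ∑ k, (if i ≠ k ∧ ‖(Torus.geometry (Fin 3)).sepVec ((Φ N).flow r z i).1 ((Φ N).flow r z k).1‖ = hsDiameter σ N
            then ENNReal.ofReal ‖((Φ N).flow r z i).2 - ((Φ N).flow r z k).2‖ else 0))
            ∂(localGibbsLaw σ (a τ) (u τ) (θ τ) N (Φ N)) = 0 :=
        mmr_lintegral_finsum_Icc_zero (Φ N) (hsDiameter_pos hσ N).ne' (hac N τ)
          (fun r z i k => ENNReal.ofReal ‖((Φ N).flow r z i).2 - ((Φ N).flow r z k).2‖)
      rw [hz, mul_zero]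
      exact bot_le
    · have hmain := cf_lintegral_collisionMarkSum_le_of_pairEnvelope hσ (Φ N) _ (hgood N τ) γ (ENNReal.ofReal (C + e N))
        (henv' N τ hτ) hbK hs0 (by linarith [hτ.1])
      exact (mul_le_mul' le_rfl hmain).trans (cf_scaled_pairEnvelope_bound_le hσ N C (e N) hJK0 hs.1 (by linarith [hτ.1]) hIK)
  · intro N s hs τ hτ hst
    rcases hs.1.eq_or_lt with h0 | hs0
    · subst h0
      have hz : ∫⁻ z, (∑ᶠ r ∈ collisionTimes (Torus.geometry (Fin 3)) (hsDiameter σ N) (fun t => (Φ N).flow t z) ∩ Set.Icc 0 0,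
          ∑ i, ∑ k, (if i ≠ k ∧ ‖(Torus.geometry (Fin 3)).sepVec ((Φ N).flow r z i).1 ((Φ N).flow r z k).1‖ = hsDiameter σ N
            then ENNReal.ofReal (‖((Φ N).flow r z i).2 - ((Φ N).flow r z k).2‖ * (‖((Φ N).flow r z i).2‖ + ‖((Φ N).flow r z k).2‖))
            else 0)) ∂(localGibbsLaw σ (a τ) (u τ) (θ τ) N (Φ N)) = 0 :=
        mmr_lintegral_finsum_Icc_zero (Φ N) (hsDiameter_pos hσ N).ne' (hac N τ)
          (fun r z i k => ENNReal.ofReal (‖((Φ N).flow r z i).2 - ((Φ N).flow r z k).2‖ * (‖((Φ N).flow r z i).2‖ + ‖((Φ N).flow r z k).2‖)))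
      rw [hz, mul_zero]
      exact bot_le
    · have hmain := cf_lintegral_collisionMarkSum_le_of_pairEnvelope hσ (Φ N) _ (hgood N τ) γ (ENNReal.ofReal (C + e N))
        (henv' N τ hτ) hbE hs0 (by linarith [hτ.1])
      exact (mul_le_mul' le_rfl hmain).trans (cf_scaled_pairEnvelope_bound_le hσ N C (e N) hJE0 hs.1 (by linarith [hτ.1]) hIE)

end Summit.AtomisticToContinuum.HydrodynamicLimit.Theorems.RestartPrinciple.AgeDuhamelForgetting

end
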